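import Summits.QuantumFields.BalabanUV.Beta.FP.RelInvPeriodisedCoarse

/-!
# `BalabanUV.Beta.FP.RelInvPeriodisedEffForm` — road «FP» (binder row D1), ROUTE T row **(T-INV)** ∕ § B (iv): THE DICTIONARY'S IDENTIFICATION `hId`
# AT ORDER 0 AS A THEOREM — the `μμ` block of the EFFECTIVE FORM of the comb-sliced periodised level-`j` system IS the periodised
# multiplier block of the decimated composite resolvent (this file, (E)); the sequel `RelInvPeriodisedEffFormCoarse` reads it as `(wVH (j+1))⁻¹ ×` the
# periodised level-`(j+1)` field block and concludes the SECOND (INV) letter `h2` UNCONDITIONALLY (`torus_h2`)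

HONEST DEPENDENCY (page 1, mandatory): continuum YM on T⁴ ⇐ BetaPertH ∧ nine spine estimates (0/9 proved); BetaPertH ⇐ (D1) ∧ (D4) ∧
CAP+tail; G-an2-4 gates asym, D1 and NE2/3/4.  HONEST FRAMING (cell contract, verbatim): «discharging `BetaPertH` makes Bałaban's UV
stability UNCONDITIONAL — a real constructive-QFT result; it is NOT the continuum limit and NOT the Clay problem.»  ABSOLUTE RULE (cell
charter, verbatim): «No internally-minted statement may enter as a cited fact. Every hypothesis is either kernel-proved in this package or a
verbatim quotation of a PUBLISHED theorem with page reference. The manuscript(s) under audit are NOT citable for their own disputed steps — they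
are the thing under adjudication; programme-internal (2001/route/tribunal) claims are never citable.»  THIS MODULE is [folklore] bookkeeping BY
NAME over: leaf-05's `RelInvPeriodisedSliced.torus_sliced_kkt` (p309426: the INVERSE of the torus sliced KKT on the live slots, `+Â` on fields,
`−Â` on multipliers, `Â = perF M (coDressKBmAt (toSite r) Lc (KInvStep Lc j))`), leaf-05's `RelInvPeriodisedCoarse` (p313296, the (INV)-2 transfer),
an5's `CompositionSingular.effForm` (`−((kkt H Q)⁻¹)₂₂`), an2's `coDressKBmAt = piKBmᵀ∘K∘piKBm` (`piKBm` is the identity on multiplier legs),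
`OneStepKernelFamily.KInvStep Lc j := dec (Lc^j) (KInv (Lc^(j+1)))`, `BalabanStepJetsSucc.E2 (j+1) := mmRead (Lc^(j+1)) (KInv (Lc^(j+1)))`,
`BorderedHessian.bhKStepAt_succ_inl_inl` (field block `= wVH · E2`), leaf-03's `kkt_fromRows_coordSlice_eq_kBig`, cap3's `regroup`, leaf-06's
`combRowsT ∕ combBondT ∕ combSlotOf ∕ childOf`.  It mints no `Prop`, has no `def`, cites nothing, 0 sorry.  «not in print; our bookkeeping».

CONTENT.
* §1 generic: `effForm_fromRows_toBlocks₁₁_apply` (`(effForm H [Q;τ]).toBlocks₁₁ a a' = −(kkt H [Q;τ])⁻¹ (inr (inl a)) (inr (inl a'))`), `inv_apply_equiv`,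
  `inv_kkt_apply_inr_inr_reindex` (re-indexing the fields does not change the multiplier–multiplier entries of the bordered inverse).
* §2 co-dressing is the identity on multiplier legs: `trK_piKBm_comp_inr`, **`coDressKBmAt_inr_inr`**, `perF_coDressKBmAt_inr_inr`.
* §3 `torus_inv_kkt_of_slots_inr_inr` (the multiplier–multiplier entries of the INVERSE of the torus sliced KKT in the slot-map form of p309426's
  `torus_isUnit_det_kkt_of_slots`: `= −Â (fμ a) (fμ a')`) and **`effForm_toBlocks₁₁_eq_perF_KInvStep`** (E): at the presentation of record (fields `(s, α) ↦ (s, inl α)` of the box `M`, `Lc ∣ Mᵢ`; coarse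
  multipliers by ANY injective `inr`-valued `fμ` with p310903's `hcoarse`; `τ₁ := combRowsT (toSite r) Lc M` read on the field slots):
  `(effForm (K̂∘(fs,fs)) [K̂∘(fμ,fs); τ₁]).toBlocks₁₁ = (perF M (KInvStep Lc j)).submatrix fμ fμ`, `K̂ := perF M (bhKStepAt d (toSite r) Lc j)` — the root
  `r` and the co-dressing drop out on multiplier legs.
* §4–§5 ((R) reading arithmetic, (F), (ID) `hId_order_zero`, (H2) `torus_h2(_record)`) are in the sequel `FP/RelInvPeriodisedEffFormCoarse` (same unit, same day).
WHAT IT IS NOT: NOT orders 1–2 of the dictionary (the jets `G₁ G₂`, `SrecOf_succ`'s cubic ∕ quartic slots — Q-FP-16-5 proper, an2); NOT the READING of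
`KInvStep` as the genuine step-`j` covariance (`OneStepKernelFamily`'s docstring promise — not needed); NOT (T-ID), NOT SDF, NOT D1, NOT BetaPertH, NOT
continuum, NOT Clay; discharges NO binder of row D1 by itself; 0 estimates.  Unit `b2b-balaban-beta-d1-formalise-leaf-05` (gen 25), 2026-08-22.
-/

noncomputable section

open scoped BigOperators Matrix

namespace Summit.QuantumFields.BalabanUV.Beta.FP.RelInvPeriodisedEffForm

open Matrix
open Literature.Probability.LatticeModels (Torus.proj)
open Literature.MathematicalPhysics.QuantumFieldTheory.Balaban1983to89
open Literature.MathematicalPhysics.QuantumFieldTheory.Balaban1983to89.Beta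
open Literature.MathematicalPhysics.QuantumFieldTheory.Balaban1983to89.Beta.Composition (kkt)
open Literature.MathematicalPhysics.QuantumFieldTheory.Balaban1983to89.Beta.CompositionSingular (effForm)
open B4TorusKernel.MultiPeriod (translate)
open B5Prop11Plancherel (fine)
open B6Lemma24Torus (pbox)
open ExpKernelCalculus (MKer comp)
open AffineAveraging (Site box toSite)
open OneStepResolventKernel (Fib KInv)
open OneStepKernelFamily (KInvStep dec legSet legPt legW)
open BalabanStepJetsSucc (E2 wVH mmRead)
open Summit.QuantumFields.BalabanUV.Beta.TameKernelCalculus (trK)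
open Summit.QuantumFields.BalabanUV.Beta.AxialDressingRooted (coDressKBmAt coDressKBmAt_eq piKBm piKBm_inl_inr piKBm_inr_inr comp_piKBm_inr
  tsum_point' axEc axEc_inl_inl axEc_inr_inr IsCombBondAt)
open Summit.QuantumFields.BalabanUV.Beta.BorderedHessian (bhKStepAt bhKStepAt_succ_inl_inl)
open Summit.QuantumFields.BalabanUV.Beta.SaddleInverse (regroup)
open Summit.QuantumFields.BalabanUV.Beta.FP.KernelPeriodisationFib (Idx perF perF_apply perZ_apply)
open Summit.QuantumFields.BalabanUV.Beta.FP.TorusCombForest (baseOf axisOf)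
open Summit.QuantumFields.BalabanUV.Beta.FP.TorusCombRows (Res combBondT combRowsT combBondT_eq baseOf_mem_pbox)
open Summit.QuantumFields.BalabanUV.Beta.FP.TorusCombSlots (CombSlot combSlotOf childOf combSlotOf_childOf combSlotOf_val combBondT_injective)
open Summit.QuantumFields.BalabanUV.Beta.FP.RelInvCompression (kkt_fromRows_coordSlice_eq_kBig)
open Summit.QuantumFields.BalabanUV.Beta.FP.RelInvPeriodisedSliced (torus_sliced_kkt kkt_submatrix_equiv)
open Summit.QuantumFields.BalabanUV.Beta.FP.RelInvPeriodisedCoarse (coarse_det_kkt_ne_zero)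

/-! ## §1 Generic: the `μμ` block of the effective form of a sliced system; inverse entries under re-indexing -/

section Generic

variable {𝕜 : Type*} [Field 𝕜]
variable {ν ν' μ ρ : Type*} [Fintype ν] [Fintype ν'] [Fintype μ] [Fintype ρ] [DecidableEq ν] [DecidableEq ν'] [DecidableEq μ] [DecidableEq ρ]

/-- [folklore] The `μμ` block of `effForm H [Q;τ] = −((kkt H [Q;τ])⁻¹)₂₂` entrywise. -/
theorem effForm_fromRows_toBlocks₁₁_apply (H : Matrix ν ν 𝕜) (Q : Matrix μ ν 𝕜) (τ : Matrix ρ ν 𝕜) (a a' : μ) :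
    (effForm H (fromRows Q τ)).toBlocks₁₁ a a' = -((kkt H (fromRows Q τ))⁻¹ (Sum.inr (Sum.inl a)) (Sum.inr (Sum.inl a'))) := rfl

omit [Fintype μ] [Fintype ρ] [DecidableEq μ] [DecidableEq ρ] in
/-- [folklore] Inverse entries along an equivalence: `A⁻¹ (e i) (e j) = (A.submatrix e e)⁻¹ i j`. -/
theorem inv_apply_equiv (A : Matrix ν ν 𝕜) (e : ν' ≃ ν) (i j : ν') : A⁻¹ (e i) (e j) = (A.submatrix e e)⁻¹ i j := by
  rw [Matrix.inv_submatrix_equiv]; rfl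

omit [Fintype μ] [DecidableEq μ] in
/-- [folklore] **RE-INDEXING THE FIELDS DOES NOT CHANGE THE MULTIPLIER–MULTIPLIER ENTRIES OF THE BORDERED INVERSE**:
`(kkt H Q)⁻¹ (inr x) (inr x') = (kkt (H∘(e,e)) (Q∘(id,e)))⁻¹ (inr x) (inr x')`. -/
theorem inv_kkt_apply_inr_inr_reindex {κ : Type*} [Fintype κ] [DecidableEq κ] (H : Matrix ν ν 𝕜) (Q : Matrix κ ν 𝕜) (e : ν' ≃ ν) (x x' : κ) :
    (kkt H Q)⁻¹ (Sum.inr x) (Sum.inr x') = (kkt (H.submatrix e e) (Q.submatrix id e))⁻¹ (Sum.inr x) (Sum.inr x') := by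
  have hc : (Sum.map e (Equiv.refl κ) : ν' ⊕ κ → ν ⊕ κ) = (Equiv.sumCongr e (Equiv.refl κ)) := rfl
  rw [show Q.submatrix id e = Q.submatrix (Equiv.refl κ) e from rfl, kkt_submatrix_equiv, hc, Matrix.inv_submatrix_equiv]
  rfl

end Generic

/-! ## §2 The block-mean co-dressing is the identity on multiplier legs -/

section CoDress

variable {d : ℕ} (ρ : Fin (d + 1) → ℤ) (N : ℕ)

/-- [folklore] Left composition with `piKBmᵀ` does not touch a multiplier ROW. -/
theorem trK_piKBm_comp_inr (K : MKer (d + 1) (Fib d)) (x y : Fin (d + 1) → ℤ) (m : Fin (d + 1)) (b : Fib d) :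
    comp (trK (piKBm ρ N)) K x y (Sum.inr m) b = K x y (Sum.inr m) b := by
  unfold ExpKernelCalculus.comp
  have h : ∀ u, ∑ f : Fib d, trK (piKBm ρ N) x u (Sum.inr m) f * K u y f b = if u = x then K u y (Sum.inr m) b else 0 := by
    intro u
    rw [Fintype.sum_sum_type]
    simp only [trK, piKBm_inl_inr, zero_mul, Finset.sum_const_zero, zero_add, piKBm_inr_inr]
    by_cases hu : u = x
    · simp only [hu, true_and, ite_mul, one_mul, zero_mul, Finset.sum_ite_eq', Finset.mem_univ, if_true]
    · simp [hu]
  simp_rw [h]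
  rw [tsum_point']

/-- [folklore] **THE CO-DRESSED KERNEL AGREES WITH THE KERNEL ON MULTIPLIER–MULTIPLIER LEGS**: `(piKBmᵀ∘K∘piKBm) x y (inr m) (inr m') = K x y (inr m) (inr m')`. -/
theorem coDressKBmAt_inr_inr (K : MKer (d + 1) (Fib d)) (x y : Fin (d + 1) → ℤ) (m m' : Fin (d + 1)) :
    coDressKBmAt ρ N K x y (Sum.inr m) (Sum.inr m') = K x y (Sum.inr m) (Sum.inr m') := by
  rw [coDressKBmAt_eq, comp_piKBm_inr, trK_piKBm_comp_inr]

/-- [folklore] … hence so does its periodisation: `perF M (coDressKBmAt ρ N K) (s, inr m) (s', inr m') = perF M K (s, inr m) (s', inr m')`. -/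
theorem perF_coDressKBmAt_inr_inr (M : Fin (d + 1) → ℕ) (K : MKer (d + 1) (Fib d)) (s s' : ↥(pbox M)) (m m' : Fin (d + 1)) :
    perF M (coDressKBmAt ρ N K) (s, Sum.inr m) (s', Sum.inr m') = perF M K (s, Sum.inr m) (s', Sum.inr m') := by
  rw [perF_apply, perF_apply, perZ_apply, perZ_apply]
  exact tsum_congr fun t => coDressKBmAt_inr_inr ρ N K _ _ m m'

end CoDress

/-! ## §3 (E) The `μμ` block of the effective form of the comb-sliced periodised level-`j` system -/

section EffForm

variable {d : ℕ} {Lc : ℕ} [NeZero Lc] {r : Fin (d + 1) → ℕ} (M : Fin (d + 1) → ℕ) [∀ μ, NeZero (M μ)]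

/-- **[folklore] THE MULTIPLIER–MULTIPLIER ENTRIES OF THE INVERSE OF THE TORUS SLICED KKT, SLOT-MAP FORM** (the companion of
`RelInvPeriodisedSliced.torus_isUnit_det_kkt_of_slots`, same hypotheses): fine bonds presented by `fν`, coarse multipliers by `fμ`, the comb by `cb : ρ₁ → ν`
(`hlive` = the `axEc`-live reading), `τ₁ x b := [b = cb x]`; then `(kkt (K̂∘(fν,fν)) [K̂∘(fμ,fν); τ₁])⁻¹ (inr (inl a)) (inr (inl a')) = −Â (fμ a) (fμ a')`,
`Â := perF M (coDressKBmAt (toSite r) Lc (KInvStep Lc j))` — `torus_sliced_kkt`'s live corner, read on the multiplier rows through cap3's `regroup`. -/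
theorem torus_inv_kkt_of_slots_inr_inr (hr : r ∈ box (d + 1) Lc) (hM : ∀ i, Lc ∣ M i) (j : ℕ)
    {ν μ ρ₁ : Type*} [Fintype ν] [Fintype μ] [Fintype ρ₁] [DecidableEq ν] [DecidableEq μ] [DecidableEq ρ₁]
    (fν : ν → Idx M (Fib d)) (fμ : μ → Idx M (Fib d)) (hfν : Function.Injective fν) (hfμ : Function.Injective fμ)
    (hν : ∀ b : ν, ∃ α : Fin (d + 1), (fν b).2 = Sum.inl α) (hμ : ∀ a : μ, ∃ m : Fin (d + 1), (fμ a).2 = Sum.inr m)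
    (cb : ρ₁ → ν) (hcb : Function.Injective cb)
    (hlive : ∀ p : Idx M (Fib d),
      axEc (toSite r) Lc p.1 p.1 p.2 p.2 = 1 ↔ (∃ b, b ∉ Set.range cb ∧ fν b = p) ∨ p ∈ Set.range fμ) (a a' : μ) :
    (kkt ((perF M (bhKStepAt d (toSite r) Lc j)).submatrix fν fν)
      (fromRows ((perF M (bhKStepAt d (toSite r) Lc j)).submatrix fμ fν)
        (Matrix.of fun (x : ρ₁) (b : ν) => if b = cb x then (1 : ℝ) else 0)))⁻¹ (Sum.inr (Sum.inl a)) (Sum.inr (Sum.inl a'))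
      = -(perF M (coDressKBmAt (toSite r) Lc (KInvStep (d := d) Lc j)) (fμ a) (fμ a')) := by
  classical
  set Mh := perF M (bhKStepAt d (toSite r) Lc j) with hMh
  -- live presentation `f := fν off the comb ⊕ fμ`, dead presentation `g := fν ∘ cb` (as in `torus_isUnit_det_kkt_of_slots`)
  let f : {b : ν // b ∉ Set.range cb} ⊕ μ → Idx M (Fib d) := Sum.elim (fun b => fν b) fμ
  let g : ρ₁ → Idx M (Fib d) := fun x => fν (cb x)
  have hf : Function.Injective f := by
    rintro (b | a₁) (b' | a₁') h
    · exact congrArg Sum.inl (Subtype.ext (hfν h))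
    · obtain ⟨α, hα⟩ := hν b; obtain ⟨m, hm⟩ := hμ a₁'
      have e : (fν b).2 = (fμ a₁').2 := congrArg Prod.snd h; rw [hα, hm] at e; exact absurd e Sum.inl_ne_inr
    · obtain ⟨α, hα⟩ := hν b'; obtain ⟨m, hm⟩ := hμ a₁
      have e : (fμ a₁).2 = (fν b').2 := congrArg Prod.snd h; rw [hα, hm] at e; exact absurd e Sum.inr_ne_inl
    · exact congrArg Sum.inr (hfμ h)
  have hlive' : ∀ p : Idx M (Fib d), axEc (toSite r) Lc p.1 p.1 p.2 p.2 = 1 ↔ p ∈ Set.range f := by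
    intro p
    rw [hlive p]
    constructor
    · rintro (⟨b, hb, rfl⟩ | ⟨a₁, rfl⟩)
      exacts [⟨Sum.inl ⟨b, hb⟩, rfl⟩, ⟨Sum.inr a₁, rfl⟩]
    · rintro ⟨b | a₁, rfl⟩
      exacts [Or.inl ⟨b, b.2, rfl⟩, Or.inr ⟨a₁, rfl⟩]
  obtain ⟨-, hI⟩ := torus_sliced_kkt M hr hM j f hf hlive' (fun b => hν b) hμ g
  let eν : {b : ν // b ∉ Set.range cb} ⊕ ρ₁ ≃ ν :=
    ((Equiv.sumComm _ _).trans (Equiv.sumCongr (Equiv.ofInjective cb hcb) (Equiv.refl _))).trans (Equiv.sumCompl fun b => b ∈ Set.range cb)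
  have heν_inl : ∀ b : {b : ν // b ∉ Set.range cb}, eν (Sum.inl b) = b := fun b => rfl
  have heν_inr : ∀ x : ρ₁, eν (Sum.inr x) = cb x := fun x => rfl
  have hsys : kkt ((Mh.submatrix fν fν).submatrix eν eν)
        ((fromRows (Mh.submatrix fμ fν) (Matrix.of fun (x : ρ₁) (b : ν) => if b = cb x then (1 : ℝ) else 0)).submatrix id eν)
      = kkt (fromBlocks (Mh.submatrix (f ∘ Sum.inl) (f ∘ Sum.inl)) (Mh.submatrix (f ∘ Sum.inl) g) (Mh.submatrix g (f ∘ Sum.inl))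
            (Mh.submatrix g g))
          (fromRows (fromCols (Mh.submatrix (f ∘ Sum.inr) (f ∘ Sum.inl)) (Mh.submatrix (f ∘ Sum.inr) g))
            (fromCols (0 : Matrix ρ₁ {b : ν // b ∉ Set.range cb} ℝ) (1 : Matrix ρ₁ ρ₁ ℝ))) := by
    congr 1
    · ext (b | x) (b' | x') <;> rfl
    · ext (a₁ | x) (b' | x') <;> try rfl
      · simp only [submatrix_apply, id, fromRows_apply_inr, fromCols_apply_inl, of_apply, heν_inl, Matrix.zero_apply]
        exact if_neg fun h : (b' : ν) = cb x => b'.2 ⟨x, h.symm⟩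
      · simp only [submatrix_apply, id, fromRows_apply_inr, fromCols_apply_inr, of_apply, heν_inr]
        by_cases h : x = x'
        · subst h; rw [if_pos rfl, Matrix.one_apply_eq]
        · rw [if_neg fun e => h (hcb e).symm, Matrix.one_apply_ne h]
  rw [inv_kkt_apply_inr_inr_reindex _ _ eν (Sum.inl a) (Sum.inl a'), hsys]
  -- the multiplier row `a` of the `kBig` presentation is `regroup o μ ρ₁ (inl (inr a))` BY `rfl`; `torus_sliced_kkt` gives `−Â` there
  have h := hI (Sum.inr a) (Sum.inr a')
  simp only [Sum.elim_inr, neg_mul, one_mul] at h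
  exact h

set_option synthInstance.maxSize 1024 in
/-- **[folklore] (E) THE `μμ` BLOCK OF THE EFFECTIVE FORM OF THE COMB-SLICED PERIODISED LEVEL-`j` SYSTEM IS THE PERIODISED MULTIPLIER BLOCK OF THE DECIMATED
COMPOSITE RESOLVENT** — at the presentation of record (fields `(s, α) ↦ (s, inl α)`; coarse multipliers by any injective `inr`-valued `fμ` with `hcoarse`; `τ₁ :=`
leaf-06's `combRowsT (toSite r) Lc M` read on the field slots): `(effForm H₀ [Q₁₀; τ₁]).toBlocks₁₁ = (perF M (KInvStep Lc j))∘(fμ, fμ)`.  The root `r` and the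
co-dressing drop out (§2). -/
theorem effForm_toBlocks₁₁_eq_perF_KInvStep (hr : r ∈ box (d + 1) Lc) (hM : ∀ i, Lc ∣ M i) (j : ℕ)
    {μ : Type*} [Fintype μ] [DecidableEq μ] (fμ : μ → Idx M (Fib d)) (hfμ : Function.Injective fμ)
    (hμ : ∀ a : μ, ∃ m : Fin (d + 1), (fμ a).2 = Sum.inr m)
    (hcoarse : ∀ (s : ↥(pbox M)) (m : Fin (d + 1)), ((s, Sum.inr m) : Idx M (Fib d)) ∈ Set.range fμ ↔ Torus.proj Lc (s : Site (d + 1)) = 0) :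
    (effForm ((perF M (bhKStepAt d (toSite r) Lc j)).submatrix (fun b : ↥(pbox M) × Fin (d + 1) => ((b.1, Sum.inl b.2) : Idx M (Fib d)))
          (fun b : ↥(pbox M) × Fin (d + 1) => ((b.1, Sum.inl b.2) : Idx M (Fib d))))
        (fromRows
          ((perF M (bhKStepAt d (toSite r) Lc j)).submatrix fμ (fun b : ↥(pbox M) × Fin (d + 1) => ((b.1, Sum.inl b.2) : Idx M (Fib d))))
          ((combRowsT (toSite r) Lc M).submatrix id (fun b : ↥(pbox M) × Fin (d + 1) => ((b.1, Sum.inl b.2) : Idx M (Fib d)))))).toBlocks₁₁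
      = (perF M (KInvStep (d := d) Lc j)).submatrix fμ fμ := by
  have hLc : 0 < Lc := Nat.pos_of_ne_zero (NeZero.ne Lc)
  have hρ : ∀ i, 0 ≤ toSite r i ∧ toSite r i < (Lc : ℤ) := fun i => by
    have h := (Fintype.mem_piFinset.mp hr) i
    rw [Finset.mem_range] at h
    exact ⟨by simp only [toSite]; positivity, by simp only [toSite]; exact_mod_cast h⟩
  set fν : ↥(pbox M) × Fin (d + 1) → Idx M (Fib d) := fun b => (b.1, Sum.inl b.2) with hfν
  -- the comb map read in the field-slot index (p310903 verbatim): `fν (cb x) = combBondT x`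
  let cb : Res (toSite r) Lc M → ↥(pbox M) × Fin (d + 1) := fun x =>
    (⟨baseOf (toSite r) Lc x.site, baseOf_mem_pbox hLc hρ hM x⟩, axisOf (toSite r) Lc x.site)
  have hcbf : ∀ x, fν (cb x) = combBondT (toSite r) Lc M x := fun x => by rw [combBondT_eq hLc hρ hM x]
  have hfν_inj : Function.Injective fν := by
    rintro ⟨s, α⟩ ⟨s', α'⟩ h
    simp only [hfν, Prod.mk.injEq, Sum.inl.injEq] at h
    exact Prod.ext h.1 h.2
  have hcb : Function.Injective cb := fun x y h =>
    combBondT_injective hLc hρ hM (by rw [← hcbf, ← hcbf, h])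
  have hτ : (combRowsT (toSite r) Lc M).submatrix id fν = Matrix.of fun x b => if b = cb x then (1 : ℝ) else 0 := by
    ext x b
    rw [submatrix_apply, of_apply, id, combRowsT, ← hcbf]
    by_cases h : b = cb x
    · rw [if_pos (congrArg fν h), if_pos h]
    · rw [if_neg (fun e => h (hfν_inj e)), if_neg h]
  -- the live reading (p310903 verbatim)
  have hlive : ∀ p : Idx M (Fib d),
      axEc (toSite r) Lc p.1 p.1 p.2 p.2 = 1 ↔ (∃ b, b ∉ Set.range cb ∧ fν b = p) ∨ p ∈ Set.range fμ := by
    rintro ⟨s, α | m⟩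
    · rw [axEc_inl_inl]
      constructor
      · intro h
        have hnc : ¬ IsCombBondAt (toSite r) Lc α (s : Site (d + 1)) := fun hc => by
          rw [if_neg (fun h3 => h3.2.2 hc)] at h; exact zero_ne_one h
        refine Or.inl ⟨(s, α), ?_, rfl⟩
        rintro ⟨x, hx⟩
        have hslot := (combSlotOf (toSite r) Lc M hLc hρ hM x).2
        rw [combSlotOf_val, ← hcbf, hx] at hslot
        obtain ⟨m', hm', hc'⟩ := hslot
        have e : α = m' := Sum.inl_injective hm'
        subst e
        exact hnc hc'
      · rintro (⟨b, hb, hbp⟩ | ⟨a₁, ha⟩)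
        · have hbs : b = (s, α) := hfν_inj hbp
          subst hbs
          have hnc : ¬ IsCombBondAt (toSite r) Lc α (s : Site (d + 1)) := fun hc => by
            apply hb
            let q : CombSlot (toSite r) Lc M := ⟨(s, Sum.inl α), α, rfl, hc⟩
            refine ⟨childOf (toSite r) Lc M hLc hM q, hfν_inj ?_⟩
            rw [hcbf, ← combSlotOf_val hLc hρ hM, combSlotOf_childOf hLc hρ hM q]
          rw [if_pos ⟨rfl, rfl, hnc⟩]
        · obtain ⟨m, hm⟩ := hμ a₁
          rw [ha] at hm
          exact absurd hm Sum.inl_ne_inr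
    · rw [axEc_inr_inr]
      constructor
      · intro h
        have hps : Torus.proj Lc (s : Site (d + 1)) = 0 := by
          by_contra hc
          rw [if_neg (fun h3 => hc h3.2.2)] at h; exact zero_ne_one h
        exact Or.inr ((hcoarse s m).2 hps)
      · rintro (⟨b, -, hbp⟩ | ha)
        · exact absurd (congrArg Prod.snd hbp) Sum.inl_ne_inr
        · rw [if_pos ⟨rfl, rfl, (hcoarse s m).1 ha⟩]
  ext a a'
  rw [effForm_fromRows_toBlocks₁₁_apply, hτ,
    torus_inv_kkt_of_slots_inr_inr M hr hM j fν fμ hfν_inj hfμ (fun b => ⟨b.2, rfl⟩) hμ cb hcb hlive a a', neg_neg, submatrix_apply]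
  -- the co-dressing is the identity on multiplier legs
  obtain ⟨m, hm⟩ := hμ a
  obtain ⟨m', hm'⟩ := hμ a'
  rw [show fμ a = ((fμ a).1, Sum.inr m) from Prod.ext rfl hm, show fμ a' = ((fμ a').1, Sum.inr m') from Prod.ext rfl hm']
  exact perF_coDressKBmAt_inr_inr (toSite r) Lc M _ _ _ m m'

end EffForm

end Summit.QuantumFields.BalabanUV.Beta.FP.RelInvPeriodisedEffForm

end
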